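import Literature.Probability.Percolation.StaircaseConnectors
import Literature.Probability.Percolation.ArmSeparationExtSlotArith
import HarnessLib

/-!
# Junctions of the staircase corridors: ring pieces and level connectors, side by side

Topic: Probability / Percolation; family `crit-perc`. A brick of the GENERIC landing layer of
Nolin's arm-separation theorem (Nolin 2008, Thm. 11, §4.3 Prop. 12 and §4.4 [arXiv 0711.4948:
Prop. 11, Thm. 10, p. 12, Fig. 6]), towards
`Literature.Probability.Percolation.Nolin2008_prop17_quasiMult` (`FiveArmExponentFacts.lean`).

The level connector of the side `i < 6` at the piece `j` of the thin ring of radius `r = n s`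
(`Staircase.levelConn`): the connectors `connV / connD / connH` of `StaircaseConnectors.lean` on
the sides `0 / 1 / 2` and their central reflections on the sides `3 / 4 / 5`. Going up from the
radius `r` to the radius `r' = r + q s` along the connector, the piece index becomes
`Staircase.upIdx q i j` (`j + q` on the sides `0, 1, 3, 4`, whose pieces are counted from a
corner that moves, and `j` on the sides `2, 5`). The two junction facts of the corridor chains:
the ring tube `ringTube r e s (extPos n i j)` crosses the connector, and the connector crosses
the ring tube `ringTube r' e s (extPos n' i (upIdx q i j))` (plus configurations, `Tube.Crosses`).

## Main results

* `Staircase.crosses_ringTube_levelConn`, `Staircase.crosses_levelConn_ringTube`.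

## References

* P. Nolin, *Near-critical percolation in two dimensions*, Electron. J. Probab. 13 (2008), §4.3
  Prop. 12 (proof), §4.4 (arXiv 0711.4948: Prop. 11; proof of Thm. 10, p. 12, Fig. 6). [Nolin2008]
* H. Kesten, *Scaling relations for 2D-percolation*, Comm. Math. Phys. 109 (1987), Lemma 4.
  [Kesten1987]
-/

noncomputable section

namespace Literature.Probability.Percolation

open LatticeModels Tube

namespace Staircase

/-- **The level connector of the side `i` at the piece `j`** of the ring of radius `r`, up to
the radius `r'`, of half-width `e'`. [cite: Nolin2008, §4.4 (arXiv 0711.4948: proof of Thm. 10, p. 12, Fig. 6)] -/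
def levelConn (r r' e' s i j : ℕ) : Tube :=
  match i with
  | 0 => connV r r' e' (-(r : ℤ) + j * s + (s / 2 : ℕ))
  | 1 => connD r r' e' s j
  | 2 => connH (-((j : ℤ) * s) - (s / 2 : ℕ)) r r' e'
  | 3 => (connV r r' e' (-(r : ℤ) + j * s + (s / 2 : ℕ))).neg
  | 4 => (connD r r' e' s j).neg
  | 5 => (connH (-((j : ℤ) * s) - (s / 2 : ℕ)) r r' e').neg
  | _ => connV r r' e' (-(r : ℤ) + j * s + (s / 2 : ℕ))

/-- **The piece index one level up**: `j + q` on the sides `0, 1, 3, 4`, `j` on the sides `2, 5`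
(`r' = r + q s`). [folklore] -/
def upIdx (q i j : ℕ) : ℕ := if i % 3 = 2 then j else j + q

variable {r r' e e' s : ℕ}

/-- **The ring piece crosses its level connector** (`1 ≤ n = r / s`, `i < 6`, `j < n`, `r ≤ r'`,
`e ≤ e'`, `2e' ≤ s`). [cite: Nolin2008, §4.4 (arXiv 0711.4948: proof of Thm. 10, p. 12, Fig. 6)] -/
theorem crosses_ringTube_levelConn {i j : ℕ} (hr : 1 ≤ r / s) (hi : i < 6) (hj : j < r / s)
    (hrr' : r ≤ r') (hee' : e ≤ e') (hes : 2 * e' ≤ s) :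
    Crosses (ringTube r e s (extPos (r / s) i j)) (levelConn r r' e' s i j) := by
  have hes' : 2 * (e' : ℤ) ≤ s := by exact_mod_cast hes
  have h5 : (e' : ℤ) ≤ (s : ℤ) / 2 := by omega
  have h6 : 2 * ((s : ℤ) / 2) ≤ s := by omega
  have h7 : 0 ≤ (s : ℤ) / 2 := by omega
  have hj1 : ((j : ℤ) + 1) * s = j * s + s := by ring
  have hV : Crosses (vPiece r (-(r : ℤ)) e s j) (connV r r' e' (-(r : ℤ) + j * s + (s / 2 : ℕ))) :=
    crosses_vPiece_connV hrr' hee' ⟨by push_cast; linarith, by push_cast; linarith⟩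
  have hH : Crosses (hPiece 0 r e s j) (connH (-((j : ℤ) * s) - (s / 2 : ℕ)) r r' e') :=
    crosses_hPiece_connH hrr' hee' ⟨by push_cast; linarith, by push_cast; linarith⟩
  rw [ringTube_extPos hr hi hj]
  unfold pieceTube extIdx levelConn
  interval_cases i
  · exact hV
  · exact crosses_stairH_connD hrr' hee' hes j
  · simp only [show (2 : ℕ) % 3 = 2 from rfl, if_true]
    rw [show r / s - 1 - (r / s - 1 - j) = j by omega]
    exact hH
  · exact crosses_neg hV
  · exact crosses_neg (crosses_stairH_connD hrr' hee' hes j)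
  · simp only [show (5 : ℕ) % 3 = 2 from rfl, if_true]
    rw [show r / s - 1 - (r / s - 1 - j) = j by omega]
    exact crosses_neg hH

/-- **The level connector crosses the ring piece one level up** (`r' = r + q s`, `1 ≤ r / s`,
`i < 6`, `j < r / s`, `e ≤ e'`, `2e' ≤ s`). [cite: Nolin2008, §4.4 (arXiv 0711.4948: proof of Thm. 10, p. 12, Fig. 6)] -/
theorem crosses_levelConn_ringTube {i j q : ℕ} (hs : 1 ≤ s) (hr : 1 ≤ r / s) (hi : i < 6) (hj : j < r / s)
    (hq : r' = r + q * s) (hee' : e ≤ e') (hes : 2 * e' ≤ s) :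
    Crosses (levelConn r r' e' s i j) (ringTube r' e s (extPos (r' / s) i (upIdx q i j))) := by
  have hrr' : r ≤ r' := by rw [hq]; exact Nat.le_add_right _ _
  have hr's : r' / s = r / s + q := by
    rw [hq, Nat.add_mul_div_right _ _ (by omega)]
  have hr' : 1 ≤ r' / s := by rw [hr's]; omega
  have hq' : r' - r = q * s := by rw [hq]; omega
  have hqz : (r' : ℤ) = r + q * s := by rw [hq]; push_cast; ring
  have hes' : 2 * (e' : ℤ) ≤ s := by exact_mod_cast hes
  have h5 : (e' : ℤ) ≤ (s : ℤ) / 2 := by omega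
  have h6 : 2 * ((s : ℤ) / 2) ≤ s := by omega
  have h7 : 0 ≤ (s : ℤ) / 2 := by omega
  have hj1 : ((j : ℤ) + 1) * s = j * s + s := by ring
  have hjq : (((j + q : ℕ) : ℤ)) * s = j * s + q * s := by push_cast; ring
  have hjq1 : (((j + q : ℕ) : ℤ) + 1) * s = j * s + q * s + s := by push_cast; ring
  have hV : Crosses (connV r r' e' (-(r : ℤ) + j * s + (s / 2 : ℕ))) (vPiece r' (-(r' : ℤ)) e s (j + q)) :=
    crosses_connV_vPiece hrr' hee' ⟨by rw [hjq, hqz]; push_cast; linarith, by rw [hjq1, hqz]; push_cast; linarith⟩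
  have hH : Crosses (connH (-((j : ℤ) * s) - (s / 2 : ℕ)) r r' e') (hPiece 0 r' e s j) :=
    crosses_connH_hPiece hrr' hee' ⟨by push_cast; linarith, by push_cast; linarith⟩
  have hju : upIdx q i j < r' / s := by
    unfold upIdx; split_ifs <;> rw [hr's] <;> omega
  rw [ringTube_extPos hr' hi hju]
  unfold pieceTube extIdx levelConn upIdx
  interval_cases i
  · exact hV
  · exact crosses_connD_stairH hrr' hee' hes j hq'
  · simp only [show (2 : ℕ) % 3 = 2 from rfl, if_true]
    rw [show r' / s - 1 - (r' / s - 1 - j) = j by omega]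
    exact hH
  · exact crosses_neg hV
  · exact crosses_neg (crosses_connD_stairH hrr' hee' hes j hq')
  · simp only [show (5 : ℕ) % 3 = 2 from rfl, if_true]
    rw [show r' / s - 1 - (r' / s - 1 - j) = j by omega]
    exact crosses_neg hH

end Staircase

end Literature.Probability.Percolation
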